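import Summits.BirchSwinnertonDyer.Rank1Residual.O5.HeegnerLogTransportThreeTwoSidedRow149895d1Models
import Summits.BirchSwinnertonDyer.Rank1Residual.O5.HeegnerLogTransportThreeTwoSidedRow240930b1
import Summits.BirchSwinnertonDyer.Rank1Residual.O5.HeegnerLogTransportThreeLogUnitCert
import HarnessLib
import HarnessLib.Audit.Tags

/-!
# (t′) at `p = 3` — the TWO-SIDED END on the row `149895d1 ~ 16655c1` (`d_K = −356`), ROW file (§4, §4b, §5): the twist, the conductor numerals /
# `klSet` units, and the row END (o5-r2 GEN 27, part 25d; §§1–3 = the sibling MODELS file `O5/HeegnerLogTransportThreeTwoSidedRow149895d1Models.lean`)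

HONEST FRAMING. Research route; **O5 ((t′): additive potentially-supersingular reduction at an
anomalous prime) stays OPEN**; conditional on the displayed hypotheses; nothing booked; no
RESIDUAL-MAP mark, label, count or tier moves. This file contains NO new mathematics about (t′): it
instantiates the two-sided END `o5_index_unit_of_goodOrd_companion_cited_s0d_ladder` (part 25b) on the
SECOND of the three KL3 pairs on which all its finitary binders hold (o5-r2 GEN 27 memo, FINDING B; census
EVIDENCE, never a Literature fact) and discharges those binders by kernel computation (`decide +kernel` on
integer / rational certificates; no `native_decide`), exactly as part 25c did for the row of record:
(the per-binder bullets for `W`, the PAIR and `G` are in the MODELS file's module text, VERBATIM; the `Gd` bullet, the honest STILL-DISPLAYS list,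
the references and the provenance line follow here VERBATIM)

* `Gd = [0, −356, 0, −27374976, 58597023280]` — the tree's own model `G.quadraticTwist (−356)` (variable change
  `1`), globally minimal (at `2`: `v₂(Δ) = 12`, `2⁴ ∣ c₄`, minimal by the integer Kraus test; Kodaira `II*`, `c = 1`;
  `I₀*` at `89` with `c ∈ {1, 2, 4}`, `I₄` non-split at `5`, `I₁` at `3331`): `IsElliptic`, `IsGloballyMinimal`, `hGd`,
  `htamGd : 3 ∤ ∏ c_ℓ(Gd)` (every value of the bracket `{1}·{2}·{1,2,4}·{1}` is a power of `2`), `hd : d_K = −356 < −4`.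

What the row END `o5_index_unit_row149895d1` STILL DISPLAYS (honest list): the published theorems BY NAME
(`hKL`, `hYZ` PUB*, `hW20`, `hmod`, `hGZK`, `hKoG`, `hGZG`); `hρ` (`ρ̄_{W,3}` onto; instrument); the Heegner /
modular-parametrisation data over a field `K` with `d_K = −356` and the non-torsion of the two Heegner points;
the two sharp `3`-descents `hSelG`, `hSelGd`; the Manin binders `hcD`, `hc3′`. Generator of every certificate
below: `census/row_certs.py` (self-tested: it reproduces part 25c's certificates byte for byte), reusing UNCHANGED
the observatory's `tate_deep` / `tam.py`, n1011-p18's `certs_lib`, o5-r2 GEN 26's `ladder_logcert.py` and GEN 27's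
`x3e_search.py`.

References: [cite: SilvermanAEC2009, III.2.3, VII.1 Remark 1.1, VII.5 Prop. 5.1 and VII.2.2]
[cite: Silverman1994, IV.9.4, IV.10.2 and IV.11.1] [cite: Tate1975, §7] [cite: Kraus1989, Prop. 1 and Prop. 2]
[cite: SilvermanAEC2009, §C.16 (definition of L_v(T))]
[cite: CremonaAlgorithms1997, §3.2 and Table 1] [cite: KrizLi2019, Theorem 1.16 (arXiv:1609.06687v4 pp. 7-8)]
[cite: Fisher2012Hessian, Thm. 13.2 (n = 3)] [cite: KrausOesterle1992, Prop. 3 (i) ⇒ (iii) (pp. 262–263)]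
[cite: GrossZagier1986, Thm. I.6.3] [cite: Kolyvagin1990, Thm. A]

Typed by `planner-b2b-bsdres-o5-r2-g27-0` (o5-r2 GEN 27, part 25d). Target path
`O5/HeegnerLogTransportThreeTwoSidedRow149895d1.lean` (NEW leaf; imports part 25c and the built part 24 §5
`…LogUnitCert`). Nothing booked.

### cc-typer-5 GEN 20 (O5 §3.5 / O6 §3.4 typer of record) — by-name ask A-O5-G27-1 EXTENDED of o5-r2 GEN 27 (HOME/INBOX.md l.15032 P.S.: 'THEN PART 25d bd3db9fb8fdb2ae1 → NEW leaf
`O5/HeegnerLogTransportThreeTwoSidedRow149895d1.lean` and PART 25e 2a28f986143af1db → NEW leaf `O5/HeegnerLogTransportThreeTwoSidedRow430425o1.lean`'; l.15040 P.S. 2 offers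
pre-split CERT/END halves and adds 'if you prefer your own split of those, no objection either — by sha, byte-identical declaration blocks, or not at all'; the UNSPLIT texts
'remain the reference'); memo `HOME/b2b-bsdres-o5-r2/gen27/O5-GEN27.md`; order of record 25 p361579 → 25b p362101 → 25c MODELS p362747 / ROW p363319 → 25d → 25e → part 26.

Source: `HOME/b2b-bsdres-o5-r2/gen27/lean/HeegnerLogTransportThreeTwoSidedRow149895d1.lean` sha16 `bd3db9fb8fdb2ae1` (467 l., the UNSPLIT reference text; `gen27/SHA16.txt`; o5-r2's joint scratch
`gen27/lean/scratch/concat_25_25b_25c_25d_25e.lean` 1dfe05c640d653b3 farm rc 0 / 0 warn / 0 sorry, axioms of both row ENDs standard, negative control `probe_false.lean` rejected),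
re-hashed by the typer right before writing.  SPLIT (typer; 467 lines exceed the gate's 400-line `lint.size` for NEW files; the TYPER'S OWN split, in the SAME shape as 25c so that
the module holding the row END keeps the ASKED name and part 26's three `import …TwoSidedRow…` lines resolve byte-identically — o5-r2's pre-split halves use a `…Cert` sibling
whose name the 25c placement did not create): every declaration block byte-identical to the UNSPLIT source and in source order, SAME namespaces
`…O5.HeegnerLogTransport[.KL3TwoSidedRows]` (every FQN is the source's); script `class-closure/typer-5/gen20/g27rows_split.py`, anchors located by content and asserted:
  MODELS = `O5/HeegnerLogTransportThreeTwoSidedRow149895d1Models.lean` = source l.1–55 (imports + module text UNCHANGED) + this ¶ + l.56–305 (§1 the three models + `IsElliptic` / `IsGloballyMinimal` +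
           integral models, §1b `hcong` UNCONDITIONAL from the X3E certificate, §2 `hadd` / `htam`, §3 `htamG` / `hordG` / `nsCount` / the unit-log ladder `steps_…` / `xf_…` / `yf_…`
           + `logUnitOKQ` check) + `end KL3TwoSidedRows` + `end …HeegnerLogTransport`; curve / ladder `def`s ⇒ kind definition (async-audit lane).  ONE TYPER LINT EDIT (gate-forced,
           the same `lint.docstring` as 25c MODELS p362747): a one-line docstring before each of the three `instance : _.IsGloballyMinimal := …` lines (source l.147–149);
  ROW    = `O5/HeegnerLogTransportThreeTwoSidedRow149895d1.lean` (the ASKED module name; holds the row END) = `import …HeegnerLogTransportThreeTwoSidedRow149895d1Models` (+ the source's other imports) + a header assembled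
           from source l.10–16 / l.33–55 VERBATIM + this ¶ + source l.58–89 (`open`s, namespaces) + l.306–467 VERBATIM (§4 the twist: `hGd`,
           `htamGd`; §4b conductor numerals, local signs, `hunitW` / `hunitG` incl. the source's scoped `Fact (Nat.Prime _)` instance; `end KL3TwoSidedRows`; §5 the row END);
           theorems + one scoped instance ⇒ kind as the gate infers.
  THIS file = ROW (MODELS = p364750, this seat, in the tree).
Checks by the typer before each proposal: DEDUP `lean search --decl` none; standalone farm `lean check` on TREE imports (rc 0 / 0 warnings / 0 sorries; ROW after MODELS'
olean — joint concat scratch meanwhile), `#print axioms` of the row END standard, dry-run clean; imports in the tree: 25c ROW `…TwoSidedRow240930b1` (p363319), part 24 CERT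
`…LogUnitCert` (p360315).  CONTENT LABELS (source, unchanged): curve-literal and ladder-data `def`s + instances + theorems
(`decide +kernel` / `norm_num`, no `native_decide`), 0 `@[conjecture]`, 0 Literature facts (net named-fact debt 0), no `sorry`; per-pair EVIDENCE made kernel-exact for ONE row;
the row END stays CONDITIONAL on the displayed published theorems BY NAME + `hρ` + Heegner data + the two 3-descents + Manin binders (the module text's honest list).
HONEST FRAMING (cell `b2b-bsdres`): research route, lane CLASS-CLOSURE §3.5 O5; nothing booked, no mark / label / count / tier of `RESIDUAL-MAP.md` moves; census (FINDING A / B)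
= EVIDENCE, never a Literature fact; O5 OPEN.
-/

open scoped Classical

open WeierstrassCurve Literature.NumberTheory.EllipticCurves
  Literature.NumberTheory.EllipticCurves.ModularForms
  Literature.NumberTheory.EllipticCurves.Rank1Residual
  Literature.NumberTheory.EllipticCurves.Rank1Residual.Typed
open Literature.NumberTheory.EllipticCurves.Rank1Residual.X11RankOneCertificates (countPoints)
open Literature.NumberTheory.EllipticCurves.Fisher2012 (hesseC4three hesseC6three eval_hesseC4three eval_hesseC6three)
open Summit.BirchSwinnertonDyer.BirchSwinnertonDyer.Rank1Residual.IntModel (integralModelInt_eq_of_map_eq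
  hasMultiplicativeReductionAtPrime_of_intModel hasSplitMultiplicativeReductionAtPrime_of_intModel_of_root
  not_hasSplitMultiplicativeReductionAtPrime_of_intModel_of_noroot)
open Summit.BirchSwinnertonDyer.Rank1Residual.Supersingular
  (QStep ladderRunQ qScalar reductionPointCount_eq_of_intModel_countPoints)
open Summit.BirchSwinnertonDyer.Rank1Residual.Additive (addv_of_intModel)
open Summit.BirchSwinnertonDyer.Rank1Residual.Additive.IntModelTam
  (not_dvd_tamagawaProduct_of_intModel_of_rowCheck)
open Summit.BirchSwinnertonDyer.Rank1Residual.Additive.IntModelCond (conductorNorm_eq_of_intModel_of_certs_of_eq)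
open Summit.BirchSwinnertonDyer.BirchSwinnertonDyer.Rank2Observatory.Tam (TamLocal)
open Summit.BirchSwinnertonDyer.Rank1Residual.SecondDescent (goodOrd_of_intModel)
open Summit.BirchSwinnertonDyer.Rank1Residual.X11b
  (isGloballyMinimal_of_krausCriterion_support natCard_point_eq_countPoints)
open Summit.BirchSwinnertonDyer.Rank1Residual.Additive.LocalLog
open Summit.BirchSwinnertonDyer.Rank1Residual.X1.CongruenceTransfer (TorsionIso)
open Literature.NumberTheory.EllipticCurves.Fisher2012 (threeCongruent_of_hesseCertificate_unconditional)
open IsDedekindDomain (HeightOneSpectrum)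
open Rat.HeightOneSpectrum (primesEquiv)
open scoped NumberField

namespace Summit.BirchSwinnertonDyer.Rank1Residual.O5.HeegnerLogTransport

namespace KL3TwoSidedRows

/-! ### §4 The twist `G^(−356)`: `hGd`, `htamGd` in the kernel -/

/-- **`hGd` IN THE KERNEL**: the identity variable change carries the tree's model `16655c1.quadraticTwist (−356) =
⟨0, −356·b₂/4, 0, 356²·b₄/2, −356³·b₆/4⟩` (`b₂, b₄, b₆ = 4, −432, −5195`) to `Gd356` (they are equal).
[cite: SilvermanAEC2009, III.1 and X.5.4] -/
theorem twist_G16655c1_356 :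
    ∃ C : VariableChange ℚ, C • G16655c1.quadraticTwist ((-356 : ℤ) : ℚ) = Gd356 :=
  ⟨⟨1, 0, 0, 0⟩, by
    ext <;> norm_num [WeierstrassCurve.variableChange_def, WeierstrassCurve.quadraticTwist, G16655c1, Gd356,
      WeierstrassCurve.b₂, WeierstrassCurve.b₄, WeierstrassCurve.b₆]⟩

/-- Stage-1 Tamagawa row certificate of `Gd356 = 16655c1^(−356)`: `2` `II*` (deep certificate, `(r,s,t) = (0,0,4)`, exit `10`,
`c = 1`), `5` `I₄` non-split (`2`), `89` `I₀*` (deep certificate, `c = 2 ∈ {1,2,4}`), `3331` `I₁` non-split (`1`);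
`|Δ| = 2¹²·5⁴·89⁶·3331`; engine `∏ c_ℓ = 4`. [cite: Silverman1994, IV.9.4] [cite: Tate1975, §7] -/
theorem rowCheck_Gd356 :
    TamLocal.rowCheck [⟨2, 1, 5, 0, 0, 0, 4, 12, 10, 0, 1⟩, ⟨5, 2, 3, 0, 0, 0, 0, 4, 0, 0, 2⟩,
        ⟨89, 9, 5, 0, 0, 0, 0, 6, 6, 0, 2⟩, ⟨3331, 57, 3, 0, 0, 0, 0, 1, 0, 0, 1⟩]
      ⟨0, -356, 0, -27374976, 58597023280⟩ = true := by
  decide +kernel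

/-- **`htamGd` IN THE KERNEL**: `3 ∤ ∏_ℓ c_ℓ(Gd356)` (every value of the certified bracket `{1}·{2}·{1,2,4}·{1}` is a power of `2`).
[cite: Silverman1994, IV.9.4] [cite: Tate1975, §7] -/
theorem tam3_Gd356 : ¬ 3 ∣ Gd356.tamagawaProduct :=
  not_dvd_tamagawaProduct_of_intModel_of_rowCheck intModel_Gd356 rowCheck_Gd356 3 (by decide +kernel)

/-! ### §4b The pair's binders `hunitW`, `hunitG` in the kernel: conductor numerals `149895`, `16655`, `a_ℓ = −1` at the
common bad primes `5, 3331`, hence `klSet ⊆ {3}` on both sides -/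

/-- **`N(149895d1) = 149895 = 3²·5·3331` as a KERNEL numeral**: `RNCert3 = ⟨0, 0, 0, 9, 4, 6, [⟨5, 2, 1, 0, 0⟩, ⟨3331, 57, 1, 0, 0⟩]⟩`
(`5`, `3331` non-split multiplicative), local certificates `⟨0, …⟩` at `2` (GOOD reduction, `f₂ = 0`) and `⟨3, 1, 1, 26, 9, 9, 0⟩` at `3`
(deep: Kodaira `III*`, `f₃ = 2`). Generator: `census/row_certs.py` (observatory `tate_deep` + n1011-p18 `certs_lib`, unchanged).
[cite: Silverman1994, IV.9.4, IV.10.2 and IV.11.1] [cite: CremonaAlgorithms1997, Table 1 (149895d1)] -/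
theorem conductorNorm_W149895d1 : W149895d1.conductorNorm ℤ = 149895 :=
  conductorNorm_eq_of_intModel_of_certs_of_eq intModel_W149895d1
    (c := ⟨0, 0, 0, 9, 4, 6, [⟨5, 2, 1, 0, 0⟩, ⟨3331, 57, 1, 0, 0⟩]⟩) (l₂ := ⟨0, 0, 0, 0, 0, 0, 0⟩)
    (l₃ := ⟨3, 1, 1, 26, 9, 9, 0⟩)
    (by decide +kernel) (by decide +kernel) (by decide +kernel) (by decide +kernel)

/-- **`N(16655c1) = 16655 = 5·3331` as a KERNEL numeral** (semistable, good at `2` and `3`): `RNCert3 = ⟨0, 4, 3, 0, 0, 0,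
[⟨5, 2, 4, 0, 0⟩, ⟨3331, 57, 1, 0, 0⟩]⟩`, local certificates `⟨0, …⟩` at `2` and at `3`.
[cite: Silverman1994, IV.10.2 and IV.11.1] [cite: CremonaAlgorithms1997, Table 1 (16655c1)] -/
theorem conductorNorm_G16655c1 : G16655c1.conductorNorm ℤ = 16655 :=
  conductorNorm_eq_of_intModel_of_certs_of_eq intModel_G16655c1
    (c := ⟨0, 4, 3, 0, 0, 0, [⟨5, 2, 4, 0, 0⟩, ⟨3331, 57, 1, 0, 0⟩]⟩) (l₂ := ⟨0, 0, 0, 0, 0, 0, 0⟩)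
    (l₃ := ⟨0, 0, 0, 0, 0, 0, 0⟩)
    (by decide +kernel) (by decide +kernel) (by decide +kernel) (by decide +kernel)

/-- `3331` is prime (instance for `ZMod 3331` as a field; scoped to this namespace). [folklore] -/
scoped instance fact_prime_3331 : Fact (Nat.Prime 3331) := ⟨by norm_num⟩

/-- `a₅(149895d1) = −1` (`I₁` non-split: the node-tangent quadratic is root-free mod `5`, by exhaustion). [cite: SilvermanAEC2009, §C.16] -/
theorem lFunction_W149895d1_5 : W149895d1.LFunction 5 = -1 :=
  lFunction_prime_eq_neg_one_of_intModel_of_noroot intModel_W149895d1 5 (by decide +kernel) (by decide +kernel)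
    (by decide +kernel)

/-- `a₃₃₃₁(149895d1) = −1` (`I₁` non-split: root-free mod `3331`, by exhaustion in the kernel). [cite: SilvermanAEC2009, §C.16] -/
theorem lFunction_W149895d1_3331 : W149895d1.LFunction 3331 = -1 :=
  lFunction_prime_eq_neg_one_of_intModel_of_noroot intModel_W149895d1 3331 (by decide +kernel) (by decide +kernel)
    (by decide +kernel)

/-- `a₅(16655c1) = −1` (`I₄` non-split). [cite: SilvermanAEC2009, §C.16] -/
theorem lFunction_G16655c1_5 : G16655c1.LFunction 5 = -1 :=
  lFunction_prime_eq_neg_one_of_intModel_of_noroot intModel_G16655c1 5 (by decide +kernel) (by decide +kernel)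
    (by decide +kernel)

/-- `a₃₃₃₁(16655c1) = −1` (`I₁` non-split). [cite: SilvermanAEC2009, §C.16] -/
theorem lFunction_G16655c1_3331 : G16655c1.LFunction 3331 = -1 :=
  lFunction_prime_eq_neg_one_of_intModel_of_noroot intModel_G16655c1 3331 (by decide +kernel) (by decide +kernel)
    (by decide +kernel)

/-- The primes of `3·N·N′ = 3³·5²·3331²` are `3, 5, 3331`. [folklore] -/
theorem eq_of_prime_dvd_level_149895d1 {ℓ : ℕ} (hℓ : ℓ.Prime) (h : ℓ ∣ 3 * 149895 * 16655) :
    ℓ = 3 ∨ ℓ = 5 ∨ ℓ = 3331 := by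
  have h' : ℓ ∣ 3 ^ 3 * 5 ^ 2 * 3331 ^ 2 := by norm_num at h ⊢; exact h
  rcases (Nat.Prime.dvd_mul hℓ).mp h' with h1 | h1
  · rcases (Nat.Prime.dvd_mul hℓ).mp h1 with h2 | h2
    · exact Or.inl ((Nat.prime_dvd_prime_iff_eq hℓ Nat.prime_three).mp (hℓ.dvd_of_dvd_pow h2))
    · exact Or.inr (Or.inl ((Nat.prime_dvd_prime_iff_eq hℓ (by norm_num)).mp (hℓ.dvd_of_dvd_pow h2)))
  · exact Or.inr (Or.inr ((Nat.prime_dvd_prime_iff_eq hℓ (by norm_num)).mp (hℓ.dvd_of_dvd_pow h1)))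

/-- **`hunitW` for the row IN THE KERNEL** — vacuously: every prime `ℓ ≠ 3` of `3·N·N′` divides both conductors with
`a_ℓ(149895d1) = a_ℓ(16655c1) = −1`, so Kriz–Li's depletion set is `klSet W G = {3}`. [cite: KrizLi2019, Thm. 1.16 (the set `ℓ ∣ pNN′/M`)] -/
theorem hunitW_row149895d1 :
    ∀ ℓ ∈ klSet W149895d1 G16655c1, ℓ ≠ 3 → padicValInt 3 (nsCount W149895d1 ℓ) = 0 := by
  intro ℓ hℓ h3
  exfalso
  rw [klSet, Finset.mem_filter, conductorNorm_W149895d1, conductorNorm_G16655c1] at hℓ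
  obtain ⟨hmem, h⟩ := hℓ
  have hcases := eq_of_prime_dvd_level_149895d1 (Nat.prime_of_mem_primeFactors hmem)
    (Nat.dvd_of_mem_primeFactors hmem)
  rcases h with h | h
  · exact h3 h
  rcases hcases with rfl | rfl | rfl
  · exact h3 rfl
  · exact h ⟨by norm_num, by norm_num, by rw [lFunction_W149895d1_5, lFunction_G16655c1_5]⟩
  · exact h ⟨by norm_num, by norm_num, by rw [lFunction_W149895d1_3331, lFunction_G16655c1_3331]⟩

/-- **`hunitG` for the row IN THE KERNEL** (roles swapped: `klSet G W = {3}`). [cite: KrizLi2019, Thm. 1.16 (the set `ℓ ∣ pNN′/M`)] -/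
theorem hunitG_row149895d1 :
    ∀ ℓ ∈ klSet G16655c1 W149895d1, ℓ ≠ 3 → padicValInt 3 (nsCount G16655c1 ℓ) = 0 := by
  intro ℓ hℓ h3
  exfalso
  rw [klSet, Finset.mem_filter, conductorNorm_W149895d1, conductorNorm_G16655c1] at hℓ
  obtain ⟨hmem, h⟩ := hℓ
  have hcases := eq_of_prime_dvd_level_149895d1 (Nat.prime_of_mem_primeFactors hmem)
    (by have := Nat.dvd_of_mem_primeFactors hmem; norm_num at this ⊢; exact this)
  rcases h with h | h
  · exact h3 h
  rcases hcases with rfl | rfl | rfl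
  · exact h3 rfl
  · exact h ⟨by norm_num, by norm_num, by rw [lFunction_W149895d1_5, lFunction_G16655c1_5]⟩
  · exact h ⟨by norm_num, by norm_num, by rw [lFunction_W149895d1_3331, lFunction_G16655c1_3331]⟩

end KL3TwoSidedRows

open KL3TwoSidedRows

/-! ### §5 The two-sided END on the row `149895d1 ~ 16655c1`, `d_K = −356` -/

/-- **THE TWO-SIDED END ON THE ROW `149895d1 ~ 16655c1`** — `o5_index_unit_of_goodOrd_companion_cited_s0d_ladder`
(part 25b) with `W := 149895d1`, `G := 16655c1` (ANOMALOUS good-ordinary companion), `Gd := Gd356` and EVERY finitary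
binder DISCHARGED IN THE KERNEL (§§1–4b: `IsElliptic`, `IsGloballyMinimal` ×3, `hcong` (X3E `(81:1)`, `u = 108`,
unconditional), `hadd`, `htam`, `htamG`, `hordG`, `htamGd`, `hGd`, `hd`, `hunitW`, `hunitG`, and the unit-log
certificate `h₀, steps, hrun, hk, hx, hmk` with `m = 6`, `k = 1`). For EVERY imaginary quadratic field `K` with
`d_K = −356` (`3` split, Heegner for `N`, `N′`), every pair of modular parametrisations / Heegner data and both
embeddings: `ρ̄_{W,3}` onto, Kolyvagin + Gross–Zagier for `G/K`, the non-torsion of the two Heegner points, the two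
sharp `3`-descents of `G` and `Gd356`, the Manin binders and the five published theorems BY NAME give
`ord₃ [W(K) : ℤ P_K] = 0`. Conditional theorem; research route; O5 OPEN; nothing booked.
[cite: KrizLi2019, Theorem 1.16 (arXiv:1609.06687v4 pp. 7-8)] [cite: GrossZagier1986, Thm. I.6.3]
[cite: Kolyvagin1990, Thm. A] [cite: YanZhu2026, Theorem 4.15] [cite: Fisher2012Hessian, Thm. 13.2 (n = 3)]
[cite: KrausOesterle1992, Prop. 3 (i) ⇒ (iii) (pp. 262–263)] [cite: SilvermanAEC2009, IV.6.4, VII.2.2 and X.5.4] -/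
theorem o5_index_unit_row149895d1
    (hKL : KrizLi2019.thm116_padicLogHeegner_congruence)
    (hYZ : YanZhu2026.thm415_padicValRat_bsd_rank_le_one)
    (hW20 : Wuthrich2014.lemma20_surjective_threeAdic_of_semistable)
    (hmod : exists_isNewformOf) (hGZK : rank_eq_analyticRank_of_analyticRank_le_one)
    (hρ : W149895d1.HasSurjectiveModNGaloisRep 3)
    {N N' : ℕ} [NeZero N] [NeZero N'] (D : ModularParametrizationData W149895d1 N)
    (D' : ModularParametrizationData G16655c1 N')
    (K : Type) [Field K] [NumberField K] (hK : IsImaginaryQuadratic K) (hdK : NumberField.discr K = -356)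
    (hH : SatisfiesHeegnerHypothesis N K) (hH' : SatisfiesHeegnerHypothesis N' K)
    (h3K : SatisfiesHeegnerHypothesis 3 K)
    (hKoG : kolyvagin N' G16655c1 K) (hGZG : gross_zagier N' G16655c1 K)
    (H : HeegnerDatum N (NumberField.discr K)) (H' : HeegnerDatum N' (NumberField.discr K))
    (ι : K →+* ℂ) (ι₃ : K →+* ℚ_[3])
    (P : (W149895d1.baseChange K).toAffine.Point) (P' : (G16655c1.baseChange K).toAffine.Point)
    (hP : WeierstrassCurve.Affine.Point.map ι.toRatAlgHom P = heegnerPointComplex D H)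
    (hP' : WeierstrassCurve.Affine.Point.map ι.toRatAlgHom P' = heegnerPointComplex D' H')
    (hPinf : ¬ IsOfFinAddOrder P) (hP'inf : ¬ IsOfFinAddOrder P')
    (hSelG : Nat.card (G16655c1.selmerGroup (3 : ℤ)) = 3 ^ G16655c1.mordellWeilRank)
    (hSelGd : Nat.card (Gd356.selmerGroup (3 : ℤ)) = 3 ^ Gd356.mordellWeilRank)
    (hcD : padicValInt 3 D.maninConstant = 0) (hc3' : ¬ ((3 : ℤ) ∣ D'.maninConstant)) :
    padicValNat 3 (AddSubgroup.zmultiples P).index = 0 :=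
  o5_index_unit_of_goodOrd_companion_cited_s0d_ladder hKL hYZ hW20 hmod hGZK W149895d1 G16655c1
    isCongruentModThree_149895d1_16655c1 hρ
    addv3_W149895d1 hunitW_row149895d1 hunitG_row149895d1 tam3_W149895d1 tam3_G16655c1 goodOrd3_G16655c1 Gd356
    tam3_Gd356 D D' K hK hH hH' h3K hKoG hGZG (by rw [hdK]; norm_num) (by rw [hdK]; exact twist_G16655c1_356) H H' ι ι₃
    P P' hP hP' hPinf hP'inf nonsingular_G16655c1_Q₀ steps_G16655c1 ladder_G16655c1 (k := 1) one_pos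
    padicValRat_x_six_Q₀_G16655c1 hmk_G16655c1 hSelG hSelGd hcD hc3'

end Summit.BirchSwinnertonDyer.Rank1Residual.O5.HeegnerLogTransport
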